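import Summits.SmoothPoincare4.SmoothPoincare4.Theses.ConvexBisection
import Literature.Topology.FourManifolds.HomotopyS4CompactProofs
import HarnessLib

/-!
# Line `szego-relative-index-path` — skeleton for crux `ConvexBisection.AcyclicBisectionRigidity`
(item stmt-SmoothPoincare4-10507, route `route-SmoothPoincare4-ConvexBisection`, rank 2)

Crux-plan of idea `szego-relative-index-path` (ideator 1, round 1). The card body is NOT on this hub
(triage r1-1/r1-2/r1-3: "card unreadable"); the line is built from the ideator's published evidence
`Cruxes/AcyclicBisectionRigidity/Ideas/cruxideateevidence.md` (E1: crux ⊇ PresentationSpheresStandard;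
E3: the funnel `UQF* → PresentationSpheresStandard → crux` via "a rel-seam diffeomorphism gives the
double") REPAIRED along the three triage notes and the standing `Disproof.lean` (gen 2, v8):

* UQF* ("two ℚ-acyclic Stein domains with contactomorphic boundaries are diffeomorphic by a map
  EXTENDING the contactomorphism") is FALSE — Disproof §5b / TRIAGE (Q8): `S⁴ = X_L ∪_ψ X̄_L` along
  `(S³/Q₈, ξ₁)`, `ψ` a contactomorphism moving `ker(H₁∂ → H₁X_L)`, so `ψ` extends over nothing.
  It is split here into its two surviving halves:
  `stub_acyclicTwins` (absolute: the halves are diffeomorphic — holds at the S³/Q₈ witness, `X_L = X_L`)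
  and `stub_seamExtension` (relative, CONTRACTIBLE halves only: the seam identification extends —
  "no contact cork inside a homotopy-sphere bisection", the UQF*_c that triage r1-3 records as
  surviving; the S³/Q₈ witness has `π₁ = ℤ/2` halves and is outside its scope).
* `PresentationSpheresStandard` becomes `stub_extendedSeamStandard`: an acyclic bisection with
  contractible halves whose seam map extends is standard (on paper `M ≅ D(W₁)`, the double of a
  contractible Stein 2-handlebody = `∂(W₁ × I)`, ⊇ every presentation sphere `∂H⁵(P,ε)` by E1 /
  Disproof §4b); it is the `ψ`-extends slice of crux 4 and is DERIVED below from
  `ContractibleTwistedDoubleStandard` (`extendedSeamStandard_of_crux4`, sorry-free).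
* the finite-π₁ ("torsion") sector, which E3 believed empty and Disproof §5b shows INHABITED by `S⁴`,
  is filed as its own standardness stub `stub_torsionTwistedDoubleStandard` (twins + not both halves
  contractible ⇒ `M ≅ S⁴`: Price/Kim–Miller at the one computed instance) — the residual "T3″" that
  every surviving line must carry (TRIAGE r1-1 §W3, r1-3 summary).

Composition: `compose` (generic in the four statements, sorry-free) destructures the bisection, gets
the twin diffeomorphism, splits on `ContractibleSpace W₁ ∧ ContractibleSpace W₂` (contractible ⇒ seam
extension ⇒ standard; otherwise the torsion statement); `AcyclicBisectionRigidity_of : <crux>` (by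
name) is `compose` at the four registered `stub_*` theorems — the only `sorry`s of the file.

Disproof obligations honoured: every stub keeps `M ≃ₕ S⁴` (`false_without_homotopyEquiv`, §3);
no stub concludes "`⇒ D(W)`" or "fillings unique rel ∂" in the torsion sector (§5b); the two
refutable-without-exotica stubs are exactly the §6 targets (`AcyclicTwinsDiffeomorphic`; UQF* cut
down to contractible halves), so a kill lands on a NAMED stub. The Szegő/Epstein relative-index path
(the card's analytic lever, shared with `cr-relative-index`) is the intended ENGINE of
`stub_acyclicTwins` / `stub_seamExtension` and is not typed (no CR-structure vocabulary in Literature);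
see `Lines/szego-relative-index-path.md`.
-/

noncomputable section

open scoped Manifold ContDiff Topology ContinuousMap
open Set Function
open Literature.Geometry.Symplectic Literature.AlgebraicTopology.SingularHomology CategoryTheory.Limits

-- namespace prescribed by the crux protocol (`Summit.<P>.<Sub>.Cruxes.<Crux>.<Slug>`, P = Sub)
set_option linter.dupNamespace false

namespace Summit.SmoothPoincare4.SmoothPoincare4.Cruxes.AcyclicBisectionRigidity.SzegoRelativeIndexPath

open Summit.SmoothPoincare4.SmoothPoincare4.Theses

/-- Local notation: the round 4-sphere. -/
local notation "𝕊⁴" => (Metric.sphere (0 : EuclideanSpace ℝ (Fin 5)) 1)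

/-! ## The crux hypothesis, bundled (verbatim; as in `Disproof.lean` §0) -/

/-- The ∃-hypothesis of the crux, verbatim: `M` is covered by two smoothly embedded compact Stein
domains meeting exactly along the images of their boundaries, with equal pushed-forward complex
tangencies on the seam, both halves ℚ-acyclic in positive degrees. (Same text as
`Cruxes.AcyclicBisectionRigidity.Disproof.AcyclicBisection`; copied, not imported, so that this Line
does not depend on the disprover's work file.) The crux is DEFINITIONALLY
`∀ M ≃ₕ S⁴, AcyclicBisection M → M ≅ S⁴` (see `AcyclicBisectionRigidity_of`). -/
def AcyclicBisection (M : Type) [TopologicalSpace M] [ChartedSpace (EuclideanSpace ℝ (Fin 4)) M] :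
    Prop :=
  ∃ (W₁ : Type) (_ : TopologicalSpace W₁) (_ : ChartedSpace (EuclideanHalfSpace 4) W₁)
    (_ : IsManifold (𝓡∂ 4) ∞ W₁) (_ : CompactSpace W₁) (W₂ : Type) (_ : TopologicalSpace W₂)
    (_ : ChartedSpace (EuclideanHalfSpace 4) W₂) (_ : IsManifold (𝓡∂ 4) ∞ W₂) (_ : CompactSpace W₂)
    (J₁ : SteinStructure W₁) (J₂ : SteinStructure W₂) (e₁ : W₁ → M) (e₂ : W₂ → M),
    Manifold.IsSmoothEmbedding (𝓡∂ 4) (𝓡 4) ∞ e₁ ∧ Manifold.IsSmoothEmbedding (𝓡∂ 4) (𝓡 4) ∞ e₂ ∧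
    Set.range e₁ ∪ Set.range e₂ = Set.univ ∧
    Set.range e₁ ∩ Set.range e₂ = e₁ '' (𝓡∂ 4).boundary W₁ ∧
    Set.range e₁ ∩ Set.range e₂ = e₂ '' (𝓡∂ 4).boundary W₂ ∧
    (∀ w₁ w₂, e₁ w₁ = e₂ w₂ →
      Submodule.map (mfderiv (𝓡∂ 4) (𝓡 4) e₁ w₁).toLinearMap (contactPlane J₁.J w₁) =
      Submodule.map (mfderiv (𝓡∂ 4) (𝓡 4) e₂ w₂).toLinearMap (contactPlane J₂.J w₂)) ∧
    (∀ k, 0 < k → IsZero (singularHomology ℚ ℚ W₁ k) ∧ IsZero (singularHomology ℚ ℚ W₂ k))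

/-- Sanity (`Iff.rfl`): the crux is literally "`M ≃ₕ S⁴` and `AcyclicBisection M` give `M ≅ S⁴`". -/
theorem crux_iff :
    ConvexBisection.AcyclicBisectionRigidity ↔
      ∀ (M : Type) [TopologicalSpace M] [T2Space M] [SecondCountableTopology M]
        [ChartedSpace (EuclideanSpace ℝ (Fin 4)) M] [IsManifold (𝓡 4) ∞ M],
        M ≃ₕ 𝕊⁴ → AcyclicBisection M → Nonempty (M ≃ₘ⟮𝓡 4, 𝓡 4⟯ 𝕊⁴) :=
  Iff.rfl

/-! ## The four stub statements (named `Prop`s; the registered stubs are the sorried `stub_*` theorems below)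

All four are stated over the crux's own unbundled data: `M ≃ₕ S⁴`, halves `W₁, W₂` with Stein
structures `J₁, J₂`, embeddings `e₁, e₂`, and the seven conjuncts of the bisection hypothesis verbatim
(smooth embeddings, covering, two seam equations, matched complex tangencies, ℚ-acyclicity). -/

/-- **S1 · AcyclicTwins** (UQF* with "extending" dropped; = the §6 target `AcyclicTwinsDiffeomorphic`,
shared with line minimal-factorisation-rigidity). In an acyclic common-contact Stein bisection of a
homotopy 4-sphere the two halves are diffeomorphic (abstractly — NOT rel the seam). Intended engine
(card): both boundary CR structures `J₁|Γ`, `ψ^*J₂|Γ` lie on Epstein's relative-index-zero stratum of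
`Emb(Γ, ξ)` (`R-Ind = [(σ₁+χ₁) − (σ₂+χ₂)]/4 = 0`, arXiv:math/0507547 (7.15.2)); a path inside that stratum
whose normal Stein fillings never degenerate identifies the fillings. Known: seam `S³` (Eliashberg 1990
Thm 5.1: both halves `B⁴`); lens/lens-sum seams do not occur (Disproof §5, §5c); holds at the
inhabited torsion instance (`X_L`, `X_L`). Threat (Disproof §6): the exotic contractible Stein pairs
of Akbulut–Yildiz arXiv:1901.00806 Thm 1 / Hayden–Mark–Piccirillo arXiv:1908.05269 §6.0.1 kill it iff
their induced contact structures on the common boundary are isotopic (not compared in print). -/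
def AcyclicTwins : Prop :=
  ∀ (M : Type) [TopologicalSpace M] [T2Space M] [SecondCountableTopology M]
    [ChartedSpace (EuclideanSpace ℝ (Fin 4)) M] [IsManifold (𝓡 4) ∞ M],
    M ≃ₕ 𝕊⁴ →
    ∀ (W₁ : Type) [TopologicalSpace W₁] [ChartedSpace (EuclideanHalfSpace 4) W₁]
      [IsManifold (𝓡∂ 4) ∞ W₁] [CompactSpace W₁] (W₂ : Type) [TopologicalSpace W₂]
      [ChartedSpace (EuclideanHalfSpace 4) W₂] [IsManifold (𝓡∂ 4) ∞ W₂] [CompactSpace W₂]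
      (J₁ : SteinStructure W₁) (J₂ : SteinStructure W₂) (e₁ : W₁ → M) (e₂ : W₂ → M),
    Manifold.IsSmoothEmbedding (𝓡∂ 4) (𝓡 4) ∞ e₁ → Manifold.IsSmoothEmbedding (𝓡∂ 4) (𝓡 4) ∞ e₂ →
    Set.range e₁ ∪ Set.range e₂ = Set.univ →
    Set.range e₁ ∩ Set.range e₂ = e₁ '' (𝓡∂ 4).boundary W₁ →
    Set.range e₁ ∩ Set.range e₂ = e₂ '' (𝓡∂ 4).boundary W₂ →
    (∀ w₁ w₂, e₁ w₁ = e₂ w₂ →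
      Submodule.map (mfderiv (𝓡∂ 4) (𝓡 4) e₁ w₁).toLinearMap (contactPlane J₁.J w₁) =
        Submodule.map (mfderiv (𝓡∂ 4) (𝓡 4) e₂ w₂).toLinearMap (contactPlane J₂.J w₂)) →
    (∀ k, 0 < k → IsZero (singularHomology ℚ ℚ W₁ k) ∧ IsZero (singularHomology ℚ ℚ W₂ k)) →
    Nonempty (W₁ ≃ₘ⟮𝓡∂ 4, 𝓡∂ 4⟯ W₂)

/-- **S2 · SeamExtension** (UQF* restricted to CONTRACTIBLE halves inside a homotopy-sphere bisection
— "no contact cork": the load-bearing stub of this line). If both halves are contractible and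
diffeomorphic, some diffeomorphism `Φ : W₁ → W₂` EXTENDS the seam identification: `e₂ (Φ w) = e₁ w`
for every boundary point `w` of `W₁` (i.e. the gluing contactomorphism `ψ = e₂⁻¹ ∘ e₁|∂W₁` extends).
Intended engine (card, E3): relative index zero + integral-homology-ball fillings ⇒ a non-degenerating
path in `Emb(Γ, ξ)` ⇒ Ehresmann rel `∂`. Refutable WITHOUT an exotic sphere by a CONTACT CORK: a cork
`(C, τ)` with a Stein structure whose contact structure `τ` preserves up to isotopy — then
`S⁴ = C ∪_τ C̄` (symmetric-link corks, evidence E2) violates S2 while the crux is untouched. Known data: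
for the Stein structures inducing the symmetric-link handlebody of the Akbulut cork, `τ` moves
`c⁺(ξ)` (Akbulut–Karakurt arXiv:1104.2247 Thm 4.1) so is no contactomorphism up to isotopy; the
decisive open instance is the Karakurt–Oba–Ukida planar structure `ξ₂` (arXiv:1607.07661 Thm 1.2,
`π(c⁺(ξ₂)) = 0`): is `τ^*ξ₂` isotopic to `ξ₂`? (E3). Out of scope by design: the S³/Q₈ witness of
Disproof §5b (`π₁ = ℤ/2` halves), where the seam map provably does NOT extend. -/
def SeamExtension : Prop :=
  ∀ (M : Type) [TopologicalSpace M] [T2Space M] [SecondCountableTopology M]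
    [ChartedSpace (EuclideanSpace ℝ (Fin 4)) M] [IsManifold (𝓡 4) ∞ M],
    M ≃ₕ 𝕊⁴ →
    ∀ (W₁ : Type) [TopologicalSpace W₁] [ChartedSpace (EuclideanHalfSpace 4) W₁]
      [IsManifold (𝓡∂ 4) ∞ W₁] [CompactSpace W₁] (W₂ : Type) [TopologicalSpace W₂]
      [ChartedSpace (EuclideanHalfSpace 4) W₂] [IsManifold (𝓡∂ 4) ∞ W₂] [CompactSpace W₂]
      (J₁ : SteinStructure W₁) (J₂ : SteinStructure W₂) (e₁ : W₁ → M) (e₂ : W₂ → M),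
    Manifold.IsSmoothEmbedding (𝓡∂ 4) (𝓡 4) ∞ e₁ → Manifold.IsSmoothEmbedding (𝓡∂ 4) (𝓡 4) ∞ e₂ →
    Set.range e₁ ∪ Set.range e₂ = Set.univ →
    Set.range e₁ ∩ Set.range e₂ = e₁ '' (𝓡∂ 4).boundary W₁ →
    Set.range e₁ ∩ Set.range e₂ = e₂ '' (𝓡∂ 4).boundary W₂ →
    (∀ w₁ w₂, e₁ w₁ = e₂ w₂ →
      Submodule.map (mfderiv (𝓡∂ 4) (𝓡 4) e₁ w₁).toLinearMap (contactPlane J₁.J w₁) =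
        Submodule.map (mfderiv (𝓡∂ 4) (𝓡 4) e₂ w₂).toLinearMap (contactPlane J₂.J w₂)) →
    (∀ k, 0 < k → IsZero (singularHomology ℚ ℚ W₁ k) ∧ IsZero (singularHomology ℚ ℚ W₂ k)) →
    ContractibleSpace W₁ → ContractibleSpace W₂ → Nonempty (W₁ ≃ₘ⟮𝓡∂ 4, 𝓡∂ 4⟯ W₂) →
    ∃ Φ : W₁ ≃ₘ⟮𝓡∂ 4, 𝓡∂ 4⟯ W₂, ∀ w ∈ (𝓡∂ 4).boundary W₁, e₂ (Φ w) = e₁ w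

/-- **S3 · ExtendedSeamStandard** (E1/E3's `PresentationSpheresStandard` node, in the crux's packaging:
"Stein doubles of contractible bodies are standard"). If the halves are contractible and the seam
identification extends to a diffeomorphism `Φ : W₁ → W₂`, then `M ≅ S⁴`. On paper `M ≅ W₁ ∪_ψ W₂`
with `ψ = Φ|∂`, i.e. `M ≅ D(W₁) = ∂(W₁ × I)` (uniqueness of gluing); `W₁` is a contractible Stein
2-handlebody, so `W₁ × I = H⁵(P, ε)` for a balanced presentation `P` of the trivial group and the claim
is "`∂H⁵(P, ε) ≅ S⁴`" ⊇ `PresentationSpheresStandard` (item stmt-SmoothPoincare4-3717; every `(P, ε)`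
occurs, Disproof §4b) — Andrews–Curtis-adjacent, true for AC-trivial `P` and the Akbulut–Kirby family
(Gompf 1991), no exotic candidate believed (Gompf arXiv:1603.05090 Q2.2 neighbourhood). It is the
`ψ`-extends slice of crux 4: `extendedSeamStandard_of_crux4` below derives it from
`ContractibleTwistedDoubleStandard` (item stmt-SmoothPoincare4-3546). -/
def ExtendedSeamStandard : Prop :=
  ∀ (M : Type) [TopologicalSpace M] [T2Space M] [SecondCountableTopology M]
    [ChartedSpace (EuclideanSpace ℝ (Fin 4)) M] [IsManifold (𝓡 4) ∞ M],
    M ≃ₕ 𝕊⁴ →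
    ∀ (W₁ : Type) [TopologicalSpace W₁] [ChartedSpace (EuclideanHalfSpace 4) W₁]
      [IsManifold (𝓡∂ 4) ∞ W₁] [CompactSpace W₁] (W₂ : Type) [TopologicalSpace W₂]
      [ChartedSpace (EuclideanHalfSpace 4) W₂] [IsManifold (𝓡∂ 4) ∞ W₂] [CompactSpace W₂]
      (J₁ : SteinStructure W₁) (J₂ : SteinStructure W₂) (e₁ : W₁ → M) (e₂ : W₂ → M),
    Manifold.IsSmoothEmbedding (𝓡∂ 4) (𝓡 4) ∞ e₁ → Manifold.IsSmoothEmbedding (𝓡∂ 4) (𝓡 4) ∞ e₂ →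
    Set.range e₁ ∪ Set.range e₂ = Set.univ →
    Set.range e₁ ∩ Set.range e₂ = e₁ '' (𝓡∂ 4).boundary W₁ →
    Set.range e₁ ∩ Set.range e₂ = e₂ '' (𝓡∂ 4).boundary W₂ →
    (∀ w₁ w₂, e₁ w₁ = e₂ w₂ →
      Submodule.map (mfderiv (𝓡∂ 4) (𝓡 4) e₁ w₁).toLinearMap (contactPlane J₁.J w₁) =
        Submodule.map (mfderiv (𝓡∂ 4) (𝓡 4) e₂ w₂).toLinearMap (contactPlane J₂.J w₂)) →
    (∀ k, 0 < k → IsZero (singularHomology ℚ ℚ W₁ k) ∧ IsZero (singularHomology ℚ ℚ W₂ k)) →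
    ContractibleSpace W₁ → ContractibleSpace W₂ →
    (∃ Φ : W₁ ≃ₘ⟮𝓡∂ 4, 𝓡∂ 4⟯ W₂, ∀ w ∈ (𝓡∂ 4).boundary W₁, e₂ (Φ w) = e₁ w) →
    Nonempty (M ≃ₘ⟮𝓡 4, 𝓡 4⟯ 𝕊⁴)

/-- **S4 · TorsionTwistedDoubleStandard** (the residual E3 overlooked; TRIAGE's T3″ on the torsion
sector). If the halves are diffeomorphic but NOT both contractible (for a ℚ-acyclic Stein 2-handlebody
"not contractible" means `π₁ ≠ 1`: either torsion `H₁ ≠ 0` — then on BOTH sides, `|H₁(W₁)| = |H₁(W₂)|`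
by linking-form duality in the homology sphere — or a non-trivial perfect `π₁`), then `M ≅ S⁴`.
On paper `M ≅ W ∪_ψ W̄` is a twisted double of ONE ℚ-acyclic Stein body `W` by a seam diffeomorphism
`ψ` matching the contact structures of two Stein structures on `W`; `π₁(M) = 1` forces `ψ` to move
`ker(H₁∂W → H₁W)` onto a complement (Disproof `f2sq_mayer_vietoris`), so `ψ` never extends and no
"double" statement applies. The sector is INHABITED by the round sphere: `W = X_L = N₋₂(ℝP²)`,
`∂W = S³/Q₈ = M(−1;½,½,½)` with `ξ₁` (GLS arXiv:math/0509714 Cor. 4.11), `ψ` in the class of a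
transposition of exceptional fibres, `X_L ∪_ψ X̄_L = S⁴` (Price 1977 / Kim–Miller arXiv:1805.00429 §3.1)
— Disproof §5b. Census constraints: spherical seams reduce to the prism family (Choe–Park
arXiv:1803.08749; Disproof `zmod_sq_not_prod`), lens sums are Stein-absent (Etnyre–Tosun 2022 Thm 8,
§5c). SPC4-shielded (`Disproof.shielded_of_spc4`): refutable only by an exotic `S⁴`. No engine is
claimed for it by this line; it is the hand-off point to a census / Price-type regluing classification. -/
def TorsionTwistedDoubleStandard : Prop :=
  ∀ (M : Type) [TopologicalSpace M] [T2Space M] [SecondCountableTopology M]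
    [ChartedSpace (EuclideanSpace ℝ (Fin 4)) M] [IsManifold (𝓡 4) ∞ M],
    M ≃ₕ 𝕊⁴ →
    ∀ (W₁ : Type) [TopologicalSpace W₁] [ChartedSpace (EuclideanHalfSpace 4) W₁]
      [IsManifold (𝓡∂ 4) ∞ W₁] [CompactSpace W₁] (W₂ : Type) [TopologicalSpace W₂]
      [ChartedSpace (EuclideanHalfSpace 4) W₂] [IsManifold (𝓡∂ 4) ∞ W₂] [CompactSpace W₂]
      (J₁ : SteinStructure W₁) (J₂ : SteinStructure W₂) (e₁ : W₁ → M) (e₂ : W₂ → M),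
    Manifold.IsSmoothEmbedding (𝓡∂ 4) (𝓡 4) ∞ e₁ → Manifold.IsSmoothEmbedding (𝓡∂ 4) (𝓡 4) ∞ e₂ →
    Set.range e₁ ∪ Set.range e₂ = Set.univ →
    Set.range e₁ ∩ Set.range e₂ = e₁ '' (𝓡∂ 4).boundary W₁ →
    Set.range e₁ ∩ Set.range e₂ = e₂ '' (𝓡∂ 4).boundary W₂ →
    (∀ w₁ w₂, e₁ w₁ = e₂ w₂ →
      Submodule.map (mfderiv (𝓡∂ 4) (𝓡 4) e₁ w₁).toLinearMap (contactPlane J₁.J w₁) =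
        Submodule.map (mfderiv (𝓡∂ 4) (𝓡 4) e₂ w₂).toLinearMap (contactPlane J₂.J w₂)) →
    (∀ k, 0 < k → IsZero (singularHomology ℚ ℚ W₁ k) ∧ IsZero (singularHomology ℚ ℚ W₂ k)) →
    ¬ (ContractibleSpace W₁ ∧ ContractibleSpace W₂) → Nonempty (W₁ ≃ₘ⟮𝓡∂ 4, 𝓡∂ 4⟯ W₂) →
    Nonempty (M ≃ₘ⟮𝓡 4, 𝓡 4⟯ 𝕊⁴)

/-! ## Registered stubs (the only `sorry`s of the file) -/

/-- S1 — see `AcyclicTwins`. -/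
theorem stub_acyclicTwins : AcyclicTwins := by
  sorry

/-- S2 — see `SeamExtension` (load-bearing). -/
theorem stub_seamExtension : SeamExtension := by
  sorry

/-- S3 — see `ExtendedSeamStandard`. -/
theorem stub_extendedSeamStandard : ExtendedSeamStandard := by
  sorry

/-- S4 — see `TorsionTwistedDoubleStandard`. -/
theorem stub_torsionTwistedDoubleStandard : TorsionTwistedDoubleStandard := by
  sorry

/-! ## The composition (kernel-checked, no `sorry`) -/

/-- **Composition, generic in the four statements** (sorry-free and axiom-clean on its own): twins
(S1); then either both halves are contractible — the seam map extends (S2) and the extended-seam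
bisection is standard (S3) — or not, and the torsion statement (S4) applies. Its conclusion is the
crux UNFOLDED once (`crux_iff`); the by-name conclusion is `AcyclicBisectionRigidity_of` below. -/
theorem compose (h₁ : AcyclicTwins) (h₂ : SeamExtension)
    (h₃ : ExtendedSeamStandard) (h₄ : TorsionTwistedDoubleStandard) :
    ∀ (M : Type) [TopologicalSpace M] [T2Space M] [SecondCountableTopology M]
      [ChartedSpace (EuclideanSpace ℝ (Fin 4)) M] [IsManifold (𝓡 4) ∞ M],
      M ≃ₕ 𝕊⁴ → AcyclicBisection M → Nonempty (M ≃ₘ⟮𝓡 4, 𝓡 4⟯ 𝕊⁴) := by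
  intro M _ _ _ _ _ e hb
  obtain ⟨W₁, _, _, _, _, W₂, _, _, _, _, J₁, J₂, e₁, e₂, he₁, he₂, hcov, hs₁, hs₂, hξ, hac⟩ := hb
  have htw : Nonempty (W₁ ≃ₘ⟮𝓡∂ 4, 𝓡∂ 4⟯ W₂) :=
    h₁ M e W₁ W₂ J₁ J₂ e₁ e₂ he₁ he₂ hcov hs₁ hs₂ hξ hac
  by_cases hc : ContractibleSpace W₁ ∧ ContractibleSpace W₂
  · have hext := h₂ M e W₁ W₂ J₁ J₂ e₁ e₂ he₁ he₂ hcov hs₁ hs₂ hξ hac hc.1 hc.2 htw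
    exact h₃ M e W₁ W₂ J₁ J₂ e₁ e₂ he₁ he₂ hcov hs₁ hs₂ hξ hac hc.1 hc.2 hext
  · exact h₄ M e W₁ W₂ J₁ J₂ e₁ e₂ he₁ he₂ hcov hs₁ hs₂ hξ hac hc htw

/-- **The line closes the crux** — `ConvexBisection.AcyclicBisectionRigidity` BY NAME (its type is
literally the route decl), from exactly the four registered stubs via `compose`; the only `sorry`s
it depends on are `stub_acyclicTwins`, `stub_seamExtension`, `stub_extendedSeamStandard`,
`stub_torsionTwistedDoubleStandard`. -/
theorem AcyclicBisectionRigidity_of : ConvexBisection.AcyclicBisectionRigidity :=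
  compose stub_acyclicTwins stub_seamExtension stub_extendedSeamStandard
    stub_torsionTwistedDoubleStandard

/-! ## Sanity links (sorry-free): where the stubs sit among existing items -/

/-- S3 is no harder than crux 4: `ContractibleTwistedDoubleStandard` (item stmt-SmoothPoincare4-3546)
implies `ExtendedSeamStandard` (a homotopy 4-sphere is compact — the PROVED tree fact
`compactSpace_of_homotopyEquiv_sphere_four_holds` — and crux 4 needs neither acyclicity nor the
extension). -/
theorem extendedSeamStandard_of_crux4 (h : ConvexBisection.ContractibleTwistedDoubleStandard) :
    ExtendedSeamStandard := by
  intro M _ _ _ _ _ e W₁ _ _ _ _ W₂ _ _ _ _ J₁ J₂ e₁ e₂ he₁ he₂ hcov hs₁ hs₂ hξ _ hW₁ hW₂ _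
  haveI : CompactSpace M :=
    Literature.Topology.FourManifolds.compactSpace_of_homotopyEquiv_sphere_four_holds M e
  haveI := hW₁
  haveI := hW₂
  exact h M W₁ W₂ J₁ J₂ e₁ e₂ he₁ he₂ hcov hs₁ hs₂ hξ

/-- Both `M ≅ S⁴`-concluding stubs are SECTORS of the crux itself (so, like the crux, SPC4-shielded:
`Disproof.shielded_of_spc4`) — S1 and S2 are the only stubs of this line refutable without an exotic
4-sphere. Checked as `example`s (no back-edge crux → stub is put into the obligation graph). -/
example (h : ConvexBisection.AcyclicBisectionRigidity) : TorsionTwistedDoubleStandard := by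
  intro M _ _ _ _ _ e W₁ _ _ _ _ W₂ _ _ _ _ J₁ J₂ e₁ e₂ he₁ he₂ hcov hs₁ hs₂ hξ hac _ _
  exact h M e ⟨W₁, _, _, _, _, W₂, _, _, _, _, J₁, J₂, e₁, e₂, he₁, he₂, hcov, hs₁, hs₂, hξ, hac⟩

example (h : ConvexBisection.AcyclicBisectionRigidity) : ExtendedSeamStandard := by
  intro M _ _ _ _ _ e W₁ _ _ _ _ W₂ _ _ _ _ J₁ J₂ e₁ e₂ he₁ he₂ hcov hs₁ hs₂ hξ hac _ _ _
  exact h M e ⟨W₁, _, _, _, _, W₂, _, _, _, _, J₁, J₂, e₁, e₂, he₁, he₂, hcov, hs₁, hs₂, hξ, hac⟩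

end Summit.SmoothPoincare4.SmoothPoincare4.Cruxes.AcyclicBisectionRigidity.SzegoRelativeIndexPath

end
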